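import Summits.QuantumFields.YangMills.Theorems.BalabanUVNodesN22WindowSoftTwoPointAtSlots

/-!
# NODE N22 (NE9) — A6 SMOKE TEST OF THE ACTIVITY-LEVEL CAPSTONES: `windowedNE9_localizedSum_of_activitySlots` and
# `windowedDecay_localizedSum_of_activitySlots` FIRE at the empty towers (no multi-indices, activities `H ≡ 0`), the zero probe chart and
# the zero complexification (degenerate model witness, declared)

Cell `pub-ymgap`, Track A (HUMAN RULING D-0062), WIDTH SEAT `dag-n22-w2` (g3) on node n22 = NE9; `--kind proof --supports stmt-QuantumFields-20544 --as helper`,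
COUNT-NEUTRAL; THEOREMS ONLY (0 `def`, 0 `sorry`, standard axioms).  Director-ym's standing A6 rule (№189): a knit whose located antecedent is not shown inhabited is
«A6-UNCHECKED».  This file shows the WHOLE activity-level antecedent of `…N22WindowSoftTwoPointAtSlots` (W1's slots `Bound238` ∕ `YoungLipschitz` at every tower and
level, Road 1's numerals, the complexified readings extending `emb ∘ exp ρ` and mapping into the spaces with holomorphic activities, the site weights with their
minimizer tails, `M = L^{m′}`, `δ₀ > 0`, `2κ₀ ≤ κ ≤ r₁`) is JOINTLY SATISFIABLE — by a DEGENERATE model: for EVERY family `F`, `m′`, reading maps `emb`, basis `bV`, window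
`W`, moduli `Λ ≥ 0` and `δ₀ > 0`, at the EMPTY one-step data `⟨PEmpty, ∅, 0⟩` (activities `H ≡ 0`, so (2.38) and its differenced form hold with any amplitude), the ZERO probe
chart `ρ = 0`, the ZERO complexification `ι = 0` with constant readings `Φ ≡ emb K k 1`, open sets `univ`, weights `w ≡ 0` (tails with `B₃ = 0`), numerals
`κ = r₁ = 2κ₀(64,8)`, `R = r₁ + 128 log 162 + 2`, `A = (2e^{5r₁+1}K₀(64,8)·9·64)⁻¹`, the two capstones APPLY and return W1-19b's letters for the (identically vanishing)
localized sum of the empty towers.  Nothing more: the towers ∕ reading ∕ chart OF RECORD are NOT these, and nothing of the record is claimed to meet the hypotheses.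

HONEST FRAMING (binding).  A degenerate MODEL witness (A6 smoke test), count-neutral; nothing of Bałaban's asserted or constructed; N22 NOT discharged (typed 28∕28 ·
discharged 5∕27 UNCHANGED); K3⁷ OPEN, NOT claimed; no count claim (the chair's single count line is the only count); one finite 𝕋⁴ programme at fixed ε — R4 closes the
CONDITIONAL rung `BalabanLadder.UV` only; NOTHING about the continuum limit, ℝ⁴, OS axioms, a mass gap or the Clay problem is proved or claimed by any of this.
-/

noncomputable section

open Filter Topology Metric Set
open scoped BigOperators

namespace YMDAG.N22.WindowSoftTwoPoint

open Literature.MathematicalPhysics.QuantumFieldTheory.Balaban1983to89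
open Literature.MathematicalPhysics.QuantumFieldTheory.Balaban1983to89.T4Continuum (T4Family)
open Literature.MathematicalPhysics.QuantumFieldTheory.Balaban1983to89.Node00.Sect2 (domCount domSys CPair)
open Literature.MathematicalPhysics.QuantumFieldTheory.Balaban1983to89.Node00.LocalizedSum17 (localizedSum ReadingMaps)
open Literature.MathematicalPhysics.QuantumFieldTheory.Balaban1983to89.Node00.W1 (ClusterTower ClusterStep)
open Literature.MathematicalPhysics.QuantumFieldTheory.Balaban1983to89.Node00.U3KernelLetters (WindowedNE9 WindowedDecay)
open Literature.MathematicalPhysics.QuantumFieldTheory.Balaban1983to89.B12Decay510 (delta1)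
open Literature.MathematicalPhysics.QuantumFieldTheory.Balaban1983to89.B12Decay510Window (K₁)
open Literature.MathematicalPhysics.QuantumFieldTheory.Balaban1983to89.B12TreeDecay (K₀ kappa₀ K₀_pos kappa₀_nonneg)

variable (F : T4Family)
variable {𝔸 : Type*} [NormedRing 𝔸] [NormedAlgebra ℝ 𝔸] {V : Type*} [NormedAddCommGroup V] [NormedSpace ℝ V] {ι' : Type*} [Fintype ι']

/-- The numerals of the smoke test are admissible: with `κ = r₁ = 2κ₀(64,8)`, `R = r₁ + 2·(64 log 162) + 2`, `A = (2e^{5r₁+1}K₀(64,8)·9·64)⁻¹` every numeral hypothesis of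
`windowedNE9_localizedSum_of_activitySlots` holds (the smallness with equality). -/
theorem smokeNumerals :
    0 < 1 / (2 * Real.exp (5 * (2 * kappa₀ (4 * 2 ^ 4) (2 * 4)) + 1) * K₀ 64 8 * 9 * 64) ∧ 0 ≤ 2 * kappa₀ (4 * 2 ^ 4) (2 * 4) ∧
      kappa₀ (4 * 2 ^ 4) (2 * 4) ≤ 2 * kappa₀ (4 * 2 ^ 4) (2 * 4) / 2 ∧
      2 * (1 / (2 * Real.exp (5 * (2 * kappa₀ (4 * 2 ^ 4) (2 * 4)) + 1) * K₀ 64 8 * 9 * 64)) *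
        Real.exp (5 * (2 * kappa₀ (4 * 2 ^ 4) (2 * 4)) + 1) * K₀ 64 8 * 9 * 64 ≤ 1 := by
  have hK : 0 < K₀ 64 8 := K₀_pos 64 8
  have hκ : 0 ≤ kappa₀ (4 * 2 ^ 4) (2 * 4) := kappa₀_nonneg (by positivity) _
  refine ⟨by positivity, by positivity, by linarith, le_of_eq ?_⟩
  field_simp

open Classical in
/-- ★ **THE HISTORY-LIPSCHITZ CAPSTONE FIRES (A6).**  For every family `F`, cube exponent `m′`, reading maps `emb`, basis `bV`, window `W`, moduli `Λ ≥ 0` and `δ₀ > 0`,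
ALL hypotheses of `windowedNE9_localizedSum_of_activitySlots` hold at the EMPTY towers `fun K k => ⟨PEmpty, fun _ => ∅, fun _ _ _ => 0⟩` (activities `H ≡ 0`: `Bound238` and
`YoungLipschitz` trivially), the zero chart `ρ = 0`, the zero complexification `ι = 0` with constant readings `Φ ≡ emb K k 1` on `univ` (extends `emb ∘ exp 0`; constant
activities are holomorphic; `sp := univ`), weights `w ≡ 0` with tails at `B₃ = 0`, and the numerals of `smokeNumerals` — so the theorem applies and yields W1-19b's letter
`WindowedNE9` for the localized sum of the empty towers at the zero chart.  DEGENERATE witness (declared); the objects of record are NOT these. -/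
theorem windowedNE9_localizedSum_of_activitySlots_fires_empty (m' : ℕ) (M : ℕ) [NeZero M] (hM : M = F.L ^ m') (emb : ReadingMaps F 𝔸 𝔸)
    (bV : Module.Basis ι' ℝ V) (W : Set (ℕ → ℝ)) (Λ : ℕ → ℕ → ℝ) (hΛ : ∀ k i, 0 ≤ Λ k i) {δ₀ : ℝ} (hδ₀ : 0 < δ₀) :
    WindowedNE9 F (localizedSum F (fun K k => (⟨PEmpty, fun _ => ∅, fun _ _ _ => 0⟩ : ClusterStep (F.P K) 𝔸 M k)) emb) (0 : V →L[ℝ] 𝔸) bV W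
      (delta1 δ₀ (2 * kappa₀ (4 * 2 ^ 4) (2 * 4)) ((M : ℝ) * 4))
      (fun k i => (16 * (8 * (Real.exp 1 * 9 * 64 * K₀ 64 8 ^ 2)) * (0 : ℝ) ^ 2 / (1 : ℝ) ^ 2) *
        Real.exp (delta1 δ₀ (2 * kappa₀ (4 * 2 ^ 4) (2 * 4)) ((M : ℝ) * 4) * ((M : ℝ) * 4) * 3) * K₀ (4 * 2 ^ 4) (2 * 4) * K₁ 4 (δ₀ / 2) * Λ k i) := by
  obtain ⟨hA, hr₁, hκ₀, hsmall⟩ := smokeNumerals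
  refine windowedNE9_localizedSum_of_activitySlots F m' M hM _ emb 0 bV W (fun _ _ => univ) (fun _ _ _ _ => mem_univ _) (fun _ _ _ => univ) Λ
    hA hr₁ le_rfl hκ₀ le_rfl hsmall hΛ hδ₀ le_rfl one_pos ?_ ?_ (fun _ _ => ℂ) (fun _ _ _ => 0)
    (fun K k _ _ => emb K k fun _ _ => NormedSpace.exp (0 : 𝔸)) (fun _ _ _ => univ) (fun _ _ _ => isOpen_univ) (fun _ _ _ => subset_univ _)
    ?_ ?_ (fun _ _ _ _ _ _ _ => mem_univ _) (fun _ _ _ _ => 0) (fun _ _ _ _ => le_rfl) ?_ ?_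
  · intro K k g _ Z φ _
    simp only [ClusterStep.H, Finset.sum_empty, norm_zero]
    positivity
  · intro K k g _ g' _ Z φ _
    simp only [ClusterStep.H, Finset.sum_empty, sub_self, norm_zero]
    exact mul_nonneg (Real.exp_nonneg _) (Finset.sum_nonneg fun i _ => mul_nonneg (hΛ _ _) (abs_nonneg _))
  · intro g _ K k X Z _
    simp only [ClusterStep.H, Finset.sum_empty]
    exact differentiableOn_const _
  · intro K k X B
    simp only [zero_apply]
  · intro K k X l t c
    simp only [zero_apply, norm_zero, le_refl]
  · intro K k X t
    simp only [zero_mul, le_refl]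

open Classical in
/-- ★ **THE VALUE CAPSTONE FIRES (A6).**  Likewise ALL hypotheses of `windowedDecay_localizedSum_of_activitySlots` hold at the empty towers, the zero chart, the zero
complexification with constant readings, zero weights and the smoke numerals (with `A` as above, `0 ≤ A` and the single smallness), yielding W1-19b's value letter
`WindowedDecay` for the localized sum of the empty towers at every `(μ, ν)`.  DEGENERATE witness (declared). -/
theorem windowedDecay_localizedSum_of_activitySlots_fires_empty (m' : ℕ) (M : ℕ) [NeZero M] (hM : M = F.L ^ m') (emb : ReadingMaps F 𝔸 𝔸)
    (bV : Module.Basis ι' ℝ V) (W : Set (ℕ → ℝ)) {δ₀ : ℝ} (hδ₀ : 0 < δ₀) (μ ν : Fin 4) :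
    WindowedDecay F (localizedSum F (fun K k => (⟨PEmpty, fun _ => ∅, fun _ _ _ => 0⟩ : ClusterStep (F.P K) 𝔸 M k)) emb) (0 : V →L[ℝ] 𝔸) bV W μ ν
      (delta1 δ₀ (2 * kappa₀ (4 * 2 ^ 4) (2 * 4)) ((M : ℝ) * 4)) := by
  obtain ⟨hA, hr₁, hκ₀, hsmall⟩ := smokeNumerals
  have hsmall1 : 1 / (2 * Real.exp (5 * (2 * kappa₀ (4 * 2 ^ 4) (2 * 4)) + 1) * K₀ 64 8 * 9 * 64) *
      Real.exp (5 * (2 * kappa₀ (4 * 2 ^ 4) (2 * 4)) + 1) * K₀ 64 8 * 9 * 64 ≤ 1 := by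
    have h0 : 0 ≤ 1 / (2 * Real.exp (5 * (2 * kappa₀ (4 * 2 ^ 4) (2 * 4)) + 1) * K₀ 64 8 * 9 * 64) *
        Real.exp (5 * (2 * kappa₀ (4 * 2 ^ 4) (2 * 4)) + 1) * K₀ 64 8 * 9 * 64 := by have := K₀_pos 64 8; positivity
    linarith
  refine windowedDecay_localizedSum_of_activitySlots F m' M hM _ emb 0 bV W (fun _ _ => univ) (fun _ _ _ _ => mem_univ _) (fun _ _ _ => univ)
    hA.le hr₁ le_rfl hκ₀ le_rfl hsmall1 hδ₀ le_rfl one_pos ?_ (fun _ _ => ℂ) (fun _ _ _ => 0)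
    (fun K k _ _ => emb K k fun _ _ => NormedSpace.exp (0 : 𝔸)) (fun _ _ _ => univ) (fun _ _ _ => isOpen_univ) (fun _ _ _ => subset_univ _)
    ?_ ?_ (fun _ _ _ _ _ _ _ => mem_univ _) (fun _ _ _ _ => 0) (fun _ _ _ _ => le_rfl) ?_ ?_ μ ν
  · intro K k g _ Z φ _
    simp only [ClusterStep.H, Finset.sum_empty, norm_zero]
    exact mul_nonneg hA.le (Real.exp_nonneg _)
  · intro g _ K k X Z _
    simp only [ClusterStep.H, Finset.sum_empty]
    exact differentiableOn_const _
  · intro K k X B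
    simp only [zero_apply]
  · intro K k X l t c
    simp only [zero_apply, norm_zero, le_refl]
  · intro K k X t
    simp only [zero_mul, le_refl]

end YMDAG.N22.WindowSoftTwoPoint

end
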